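import Literature.AlgebraicGeometry.Motives.GrassmannianSubbundleBilinearMap
import Literature.AlgebraicGeometry.Modules.MorphismRankLoci
import HarnessLib

/-!
# The determinantal loci of a multiplication map on the Grassmannian are (locally closed) subschemes

Topic `AlgebraicGeometry/Motives`; namespace `Literature.AlgebraicGeometry.Motives.Grassmannian`.  THEOREMS ONLY (no definition, no
instance, no notation, no named fact, no `sorry`).  (q2) FILE 2: the rank loci of ★ `subbundleFamilyMap k M b b₂ m = μ_m : ∏_{J₁} 𝒦 ⟶ 𝒪_{Gr}^{(J₂)}`
(FILE 1) as instances of ★ `Modules/MorphismRankLoci` (B-p21 (g17); Stacks 05P8 in `φ`-currency) and ★ `Modules/LocallyFreeRankLocusRepresentable`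
(B-p09 (g14)): for every `r`,

* **`exists_subfunctor_subbundleFamilyMapRankLE`** — the `g : T ⟶ Gr` with `Fit_r(coker (g^*μ_m)) = 𝒪_T` («`rank (μ_m)_T ≥ #J₂ − r`», i.e.
  «the multiplication image has corank `≤ r`») form a sub-functor of `h_{Gr}`; **`exists_iso_yoneda_subbundleFamilyMapRankLE`** — it is
  represented by the OPEN subscheme `Gr ∖ Z_r(coker μ_m)` compatibly with the inclusions; `range_eq_of_subbundleFamilyMapRankLE`;
  its classifying morphisms are open immersions by ★ `isOpenImmersion_of_rankLE` with ★ `mem_iff_fittingIdealSheaf_pullback_cokernel` as `hP`;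
* **`exists_subfunctor_subbundleFamilyMapRankEq`** — inside it, the `g` with moreover `Fit_j(coker (g^*μ_m)) = 0` for `j < r`
  («`coker (μ_m)_T` locally free of rank `r`» — the GOTZMANN / determinantal condition) form a sub-sub-functor, represented by a scheme
  with immersive classifying morphism by ★ `isImmersion_of_rankEq` / `exists_iso_yoneda_immersion_rankEq`;
* `subbundleFamilyMapFit_eq_bot_iff_le_ker` — the closed condition «`rank ≤ s`» in ideal-sheaf currency.

No Hilbert-scheme object is typed: the identification of `coker (g^*μ_m)` with «`S_{d+1} ⊗ 𝒪_T / S₁·K_T`» for the quotient classified by `g`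
is the closed core (F-5 (5d), decision (4)).  [StacksProject, Tags 05P8, 0C3D, 089R]; [GortzWedhorn2020, (8.4), Thm. 8.9].
Count-neutral Mathlib-side capital; nothing here is about HC — HC_CM is proved only modulo the 7 printed citations until rung 0 closes.
-/

noncomputable section
-- `TopCat.Presheaf`/`Scheme.Modules` are not reducible (as in Mathlib's `AlgebraicGeometry/Modules/Tilde.lean`).
set_option backward.isDefEq.respectTransparency false

open CategoryTheory Opposite TensorProduct TopologicalSpace AlgebraicGeometry Limits
open Literature.AlgebraicGeometry.Modules

namespace Literature.AlgebraicGeometry.Motives.Grassmannian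

universe u

variable (k : ℕ) (M : Type u) [AddCommGroup M] {J : Type u} [Fintype J] (b : Module.Basis J ℤ M)
  [(grassmannianSheaf M k).obj.IsRepresentable] {M₂ : Type u} [AddCommGroup M₂] {J₂ : Type u} [Fintype J₂]
  (b₂ : Module.Basis J₂ ℤ M₂) {J₁ : Type u} [Fintype J₁] (m : J₁ → (M →ₗ[ℤ] M₂)) (r : ℕ)

/-- **The sub-functor «corank of the multiplication image `≤ r`»** of `h_{Gr}`: the `g : T ⟶ Gr` with `Fit_r(coker (g^*μ_m)) = 𝒪_T`
(★ `exists_subfunctor_cokerRankLE` at `φ := μ_m`). [cite: StacksProject, Tag 05P8] [cite: GortzWedhorn2020, (8.4) (pp. 213–215)] -/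
theorem exists_subfunctor_subbundleFamilyMapRankLE :
    ∃ P : Subfunctor (yoneda.obj (grassmannianScheme M k)), ∀ {T : Scheme.{u}} (g : T ⟶ grassmannianScheme M k),
      g ∈ P.obj (op T) ↔
        fittingIdealSheaf (cokernel ((Scheme.Modules.pullback g).map (subbundleFamilyMap k M b b₂ m)))
          (isAffineLocalizing_cokernel_map_pullback _ (isAffineLocalizing_piObj_kernel_universalQuotientπ k M b)
            (isAffineLocalizing_freeModule _ J₂) g)
          (isAffineFiniteType_cokernel_map_pullback _ (isAffineLocalizing_piObj_kernel_universalQuotientπ k M b)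
            (isAffineLocalizing_freeModule _ J₂) (isAffineFiniteType_freeModule _ J₂) g) r = ⊤ :=
  exists_subfunctor_cokerRankLE (subbundleFamilyMap k M b b₂ m) (isAffineLocalizing_piObj_kernel_universalQuotientπ k M b)
    (isAffineLocalizing_freeModule _ J₂) (isAffineFiniteType_freeModule _ J₂) r

variable (P : Subfunctor (yoneda.obj (grassmannianScheme M k)))
  (hP : ∀ {T : Scheme.{u}} (g : T ⟶ grassmannianScheme M k), g ∈ P.obj (op T) ↔
    fittingIdealSheaf (cokernel ((Scheme.Modules.pullback g).map (subbundleFamilyMap k M b b₂ m)))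
      (isAffineLocalizing_cokernel_map_pullback _ (isAffineLocalizing_piObj_kernel_universalQuotientπ k M b)
        (isAffineLocalizing_freeModule _ J₂) g)
      (isAffineFiniteType_cokernel_map_pullback _ (isAffineLocalizing_piObj_kernel_universalQuotientπ k M b)
        (isAffineLocalizing_freeModule _ J₂) (isAffineFiniteType_freeModule _ J₂) g) r = ⊤)

include hP in
/-- **The «corank ≤ r» sub-functor is represented by the OPEN subscheme `Gr ∖ Z_r(coker μ_m)`** (★ `exists_iso_yoneda_compl_support_cokerRankLE`).
The classifying morphism of any representing pair is an open immersion: ★ `isOpenImmersion_of_rankLE` with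
★ `mem_iff_fittingIdealSheaf_pullback_cokernel … P hP` as its `hP`. [cite: StacksProject, Tag 05P8] [cite: GortzWedhorn2020, Thm. 8.9 (p. 212)] -/
theorem exists_iso_yoneda_subbundleFamilyMapRankLE :
    ∃ e : yoneda.obj ((fittingIdealSheaf ((Scheme.Modules.pullback (𝟙 (grassmannianScheme M k))).obj
          (cokernel (subbundleFamilyMap k M b b₂ m)))
        ((IsAffineLocalizing.cokernel _ (isAffineLocalizing_piObj_kernel_universalQuotientπ k M b)
          (isAffineLocalizing_freeModule _ J₂)).pullback (𝟙 _))
        ((IsAffineFiniteType.cokernel _ (isAffineLocalizing_piObj_kernel_universalQuotientπ k M b)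
          (isAffineLocalizing_freeModule _ J₂) (isAffineFiniteType_freeModule _ J₂)).pullback (𝟙 _)
          (IsAffineLocalizing.cokernel _ (isAffineLocalizing_piObj_kernel_universalQuotientπ k M b)
            (isAffineLocalizing_freeModule _ J₂)))
        r).support.compl : Scheme.{u}) ≅ P.toFunctor,
      e.hom ≫ P.ι = yoneda.map (Scheme.Opens.ι _) ≫ (Iso.refl (yoneda.obj (grassmannianScheme M k))).hom :=
  exists_iso_yoneda_compl_support_cokerRankLE (subbundleFamilyMap k M b b₂ m) (isAffineLocalizing_piObj_kernel_universalQuotientπ k M b)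
    (isAffineLocalizing_freeModule _ J₂) (isAffineFiniteType_freeModule _ J₂) r P hP

include hP in
/-- The image of the classifying morphism of any scheme representing the «corank ≤ r» sub-functor is `Gr ∖ Z_r(coker μ_m)`.
[cite: StacksProject, Tag 05P8] -/
theorem range_eq_of_subbundleFamilyMapRankLE {Y : Scheme.{u}} (e : yoneda.obj Y ≅ P.toFunctor) (g : Y ⟶ grassmannianScheme M k)
    (hg : yoneda.map g ≫ (Iso.refl (yoneda.obj (grassmannianScheme M k))).hom = e.hom ≫ P.ι) :
    Set.range g.base = ((fittingIdealSheaf ((Scheme.Modules.pullback (𝟙 (grassmannianScheme M k))).obj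
          (cokernel (subbundleFamilyMap k M b b₂ m)))
        ((IsAffineLocalizing.cokernel _ (isAffineLocalizing_piObj_kernel_universalQuotientπ k M b)
          (isAffineLocalizing_freeModule _ J₂)).pullback (𝟙 _))
        ((IsAffineFiniteType.cokernel _ (isAffineLocalizing_piObj_kernel_universalQuotientπ k M b)
          (isAffineLocalizing_freeModule _ J₂) (isAffineFiniteType_freeModule _ J₂)).pullback (𝟙 _)
          (IsAffineLocalizing.cokernel _ (isAffineLocalizing_piObj_kernel_universalQuotientπ k M b)
            (isAffineLocalizing_freeModule _ J₂)))
        r).support.compl : Set (grassmannianScheme M k)) :=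
  range_eq_of_cokerRankLE (subbundleFamilyMap k M b b₂ m) (isAffineLocalizing_piObj_kernel_universalQuotientπ k M b)
    (isAffineLocalizing_freeModule _ J₂) (isAffineFiniteType_freeModule _ J₂) r P hP e g hg

/-- **The GOTZMANN / determinantal sub-sub-functor «`coker (μ_m)_T` locally free of rank `r`»** exists (★ `exists_subfunctor_cokerRankEq`);
its representing scheme has an IMMERSIVE classifying morphism by ★ `isImmersion_of_rankEq` / `exists_iso_yoneda_immersion_rankEq` with
★ `mem_iff_forall_fittingIdealSheaf_pullback_cokernel` as `hQ`. [cite: StacksProject, Tag 05P8] [cite: GortzWedhorn2020, (8.4) (pp. 213–215)] -/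
theorem exists_subfunctor_subbundleFamilyMapRankEq :
    ∃ Q : Subfunctor P.toFunctor, ∀ {T : Scheme.{u}} (g : P.toFunctor.obj (op T)), g ∈ Q.obj (op T) ↔
      ∀ j < r, fittingIdealSheaf (cokernel ((Scheme.Modules.pullback (g : T ⟶ grassmannianScheme M k)).map (subbundleFamilyMap k M b b₂ m)))
        (isAffineLocalizing_cokernel_map_pullback _ (isAffineLocalizing_piObj_kernel_universalQuotientπ k M b)
          (isAffineLocalizing_freeModule _ J₂) _)
        (isAffineFiniteType_cokernel_map_pullback _ (isAffineLocalizing_piObj_kernel_universalQuotientπ k M b)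
          (isAffineLocalizing_freeModule _ J₂) (isAffineFiniteType_freeModule _ J₂) _) j = ⊥ :=
  exists_subfunctor_cokerRankEq (subbundleFamilyMap k M b b₂ m) (isAffineLocalizing_piObj_kernel_universalQuotientπ k M b)
    (isAffineLocalizing_freeModule _ J₂) (isAffineFiniteType_freeModule _ J₂) r P

/-- **The closed condition «`rank (μ_m)_T ≤ #J₂ − j − 1`»** in ideal-sheaf currency: `Fit_j(coker (g^*μ_m)) = 0 ↔ Fit_j(coker μ_m) ≤ ker g♯`
(★ `cokerFit_eq_bot_iff_le_ker`). [cite: StacksProject, Tag 0C3D] -/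
theorem subbundleFamilyMapFit_eq_bot_iff_le_ker {T : Scheme.{u}} (g : T ⟶ grassmannianScheme M k) (j : ℕ) :
    fittingIdealSheaf (cokernel ((Scheme.Modules.pullback g).map (subbundleFamilyMap k M b b₂ m)))
        (isAffineLocalizing_cokernel_map_pullback _ (isAffineLocalizing_piObj_kernel_universalQuotientπ k M b)
          (isAffineLocalizing_freeModule _ J₂) g)
        (isAffineFiniteType_cokernel_map_pullback _ (isAffineLocalizing_piObj_kernel_universalQuotientπ k M b)
          (isAffineLocalizing_freeModule _ J₂) (isAffineFiniteType_freeModule _ J₂) g) j = ⊥ ↔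
      fittingIdealSheaf (cokernel (subbundleFamilyMap k M b b₂ m))
        (IsAffineLocalizing.cokernel _ (isAffineLocalizing_piObj_kernel_universalQuotientπ k M b) (isAffineLocalizing_freeModule _ J₂))
        (IsAffineFiniteType.cokernel _ (isAffineLocalizing_piObj_kernel_universalQuotientπ k M b) (isAffineLocalizing_freeModule _ J₂)
          (isAffineFiniteType_freeModule _ J₂)) j ≤ g.ker :=
  cokerFit_eq_bot_iff_le_ker (subbundleFamilyMap k M b b₂ m) (isAffineLocalizing_piObj_kernel_universalQuotientπ k M b)
    (isAffineLocalizing_freeModule _ J₂) (isAffineFiniteType_freeModule _ J₂) g j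

end Literature.AlgebraicGeometry.Motives.Grassmannian

end
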